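import Summits.BirchSwinnertonDyer.BirchSwinnertonDyer.Theorems.SemiOrdinaryEisensteinDescentWildSplitEisensteinValueAtOneVMinfCurrency
import HarnessLib

/-!
# Route `SemiOrdinaryEisensteinDescent` (SOED), crux #2″ `WildSplitEisensteinValueAtOneV` (stmt-BirchSwinnertonDyer-26610, `E_𝟙^V`),
# line `index`: the `M_∞` currency, part 2 — WHERE the research content lives (index-excess data only) and WHAT A COUNTEREXAMPLE
# MUST BE (one Friedberg–Hoffstein datum whose derived Heegner points are all `3^{s}`-divisible to depth `ord₃(c·∏c_ℓ) + 1`)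
# (cell `pub/bsd-wall`, width seat `bsd-wall-soed-p1-w3` g18, `--supports stmt-BirchSwinnertonDyer-26610`, helper; no definition,
# no named fact, no `sorry`)

Sequel of `…WildSplitEisensteinValueAtOneVMinfCurrency` (p635290, this seat): there crux #2″ was identified, modulo print, with
`RKC₃^FH,≤` («`Koly.Minf Dt H.β ι 3 ≤ ord₃∏c_ℓ + v₃(c)` at every odd FH datum of the O6 onto `r₁` cell»). This file records the two
bookkeeping consequences a stub worker, the instrument row and the crux's disprover need, kernel-exact:

* §1 `minf_le_of_index_le_budget` — the IDLE ROWS in `M_∞` currency: where `ord₃[E(K):ℤP] ≤ ord₃∏c_ℓ + v₃(c)` the bound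
  `M_∞ ≤ ord₃∏c_ℓ + v₃(c)` already holds (p621234 §0: `I_FH` is free there; then p635290 §1 ⟹, i.e. Matar–Nekovář upper +
  Kolyvagin). So `RKC₃^FH,≤` — like `I_FH` — has content on the INDEX-EXCESS data only; `minfLeFH_iff_indexExcess` says so as an
  equivalence of the two displayed ∀-statements.
* §2 `valueAtOneV_false_of_globalDivisibility_datum` — THE SHAPE OF A REFUTATION of crux #2″ (mirror of tk5j's §C2 for J‴): ONE datum
  of the stub's binders at which EVERY derived Heegner point `P_n` — `n` a square-free product of Kolyvagin primes of index `≥ s`, `n = 1`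
  allowed, `d` any Kolyvagin–Heegner datum of conductor `n` on `(Dt, H.β, ι)` — is `3^{s}`-divisible in `E(K[n])` for every
  `s ≤ ord₃∏c_ℓ + v₃(c) + 1` refutes `E_𝟙^V`, GIVEN print {PUB, W, Matar–Nekovář upper} (such a datum has `M_∞ ≥ budget + 1` by
  `Koly.globalDivisibility_iff_le_minf`, against §2 of p635290). No `#Ш`, no `Λ`, no `p`-adic `L`-function in the target. Conversely
  (`not_globalDivisibility_of_valueAtOneV`) the crux forbids such a datum.
* §4 `sigmaMultiCarrier_iff_le_minf` (J‴ ⟺ `budget ≤ M_∞` on cut frames, DEFINITIONS ONLY) and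
  `valueAtOneV_and_sigmaMultiCarrier_iff_refinedKolyvagin`: modulo print, **`E_𝟙^V ∧ J‴` ⟺ «`M_∞ ≤ budget` at every odd FH datum ∧
  `M_∞ ≥ budget` at every cut multi-carrier one»** — the route's two open research cruxes ARE the refined Kolyvagin conjecture at the wild 3.
* §3 `valueAtOneV_iff_forall_not_globalDivisibility` — crux #2″ ⟺ «no FH datum of the cell is globally `3^{s}`-divisible to depth
  `ord₃∏c_ℓ + v₃(c) + 1`», modulo print: the ∀¬∃ form the instrument row decides pair by pair (Jetchev–Lauter–Stein 2009 §4 computes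
  `P_ℓ` mod `3^{s}`).

HONEST FRAMING: theorems only; every crux, package and named fact is a HYPOTHESIS; nothing is asserted about any curve; `E_𝟙^V` is NOT
claimed false (no datum is exhibited); closes nothing; BSD₃ is proved for no curve. No definition, no named fact, no `sorry`.

References: [MatarNekovar2019] Thm. 0.7, §0.11; [McCallumLMS1991] §4 `S_r(M)`, §5 (p. 303) `ord_p(P_n)`, `M_r`, Cor. 5.6;
[JetchevLauterStein2009] Prop. 4.1–4.2 (arXiv:0707.0032); [WZhang2014] Remark 18; [JetchevSkinnerWan2017] §7.4.1.
-/

noncomputable section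

open scoped Classical NumberField

set_option linter.dupNamespace false -- `Summit.BirchSwinnertonDyer.BirchSwinnertonDyer.Theorems.…` (summit = sub, D-0017)
set_option autoImplicit false

namespace Summit.BirchSwinnertonDyer.BirchSwinnertonDyer.Theorems.WildSplitEisensteinValueAtOneVMinfShape

open WeierstrassCurve NumberField IsDedekindDomain Field
  Literature.NumberTheory.EllipticCurves
  Literature.NumberTheory.EllipticCurves.ModularForms
  Literature.NumberTheory.EllipticCurves.Rank1Residual
  Summit.BirchSwinnertonDyer.Rank1Residual
  Summit.BirchSwinnertonDyer.Rank1Residual.Additive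
  Summit.BirchSwinnertonDyer.Rank1Residual.X11b
  Summit.BirchSwinnertonDyer.Rank1Residual.X11b.Three
  Summit.BirchSwinnertonDyer.BirchSwinnertonDyer.Theses.SemiOrdinaryEisensteinDescent
  Summit.BirchSwinnertonDyer.BirchSwinnertonDyer.Theorems

/-! ### §1 The idle rows in `M_∞` currency -/

/-- **`M_∞ ≤ ord₃∏c_ℓ + v₃(c)` is automatic where the Heegner index is within budget.** At a datum of the cell with
`ord₃[E(K):ℤP] ≤ ord₃∏c_ℓ(E) + v₃(c(Dt))`, `I_FH` holds with no input (p621234 §0), hence so does McCallum's bound (p635290 §1 ⟹; inputs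
Kolyvagin `hKo` and Matar–Nekovář 2019 Thm. 0.7 upper `hMNU`, named facts). In print this is just `M_∞ ≤ M₀` (McCallum Lemma 5.1).
CONDITIONAL; nothing asserted about any curve. [cite: McCallumLMS1991, §5 Lemma 5.1 (p. 303)] [cite: MatarNekovar2019, Thm. 0.7 (p. 456)] -/
theorem minf_le_of_index_le_budget
    (hKo : ∀ (N : ℕ) [NeZero N] (W : WeierstrassCurve ℚ) (K : Type) [Field K] [NumberField K], kolyvagin N W K)
    (hMNU : MatarNekovar2019.thm07_padicValNat_card_sha_primary_add_le_of_globalDivisibility_of_irreducible)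
    (W : WeierstrassCurve ℚ) [W.IsElliptic] [W.IsGloballyMinimal] (N : ℕ) [NeZero N]
    (K : Type) [Field K] [NumberField K]
    (Dt : ModularParametrizationData W N) (H : HeegnerDatum N (NumberField.discr K)) (ι : K →+* ℂ)
    (P : (W.baseChange K).toAffine.Point)
    (hO6 : Additive.ClassO6 W 3) (hsurj : W.HasSurjectiveModNGaloisRep 3) (hN : W.conductorNorm ℤ = N)
    (hK : IsImaginaryQuadratic K) (hHH : SatisfiesHeegnerHypothesis N K)
    (hP : WeierstrassCurve.Affine.Point.map ι.toRatAlgHom P = heegnerPointComplex Dt H)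
    (hnt : ¬ IsOfFinAddOrder P) (hodd : Odd (NumberField.discr K))
    (hidle : padicValNat 3 (AddSubgroup.zmultiples P).index ≤ padicValNat 3 W.tamagawaProduct + padicValNat 3 Dt.c.natAbs) :
    Koly.Minf Dt H.β ι 3 ≤ ((padicValNat 3 W.tamagawaProduct + padicValNat 3 Dt.c.natAbs : ℕ) : ℕ∞) :=
  WildSplitEisensteinValueAtOneVMinfCurrency.minf_le_of_indexLowerBoundLeAt_FH hKo hMNU W N K Dt H ι P hO6 hsurj hN hK hHH hP hnt
    hodd (WildSplitEisensteinValueAtOneVCertificateRoad.indexLowerBoundLeAt_of_index_le_budget W 3 K P _ hidle)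

/-- **`RKC₃^FH,≤` ⟺ its restriction to the INDEX-EXCESS data** (`ord₃[E(K):ℤP] > ord₃∏c_ℓ + v₃(c)`), modulo Kolyvagin and Matar–Nekovář
upper (§1 serves the idle rows). The research content of crux #2″ sits on the index-excess Friedberg–Hoffstein data of the cell and
nowhere else. CONDITIONAL; nothing asserted about any curve. [cite: McCallumLMS1991, §5 Lemma 5.1 (p. 303)]
[cite: JetchevSkinnerWan2017, §7.4.1 (arXiv:1512.06894 p. 30)] -/
theorem minfLeFH_iff_indexExcess
    (hKo : ∀ (N : ℕ) [NeZero N] (W : WeierstrassCurve ℚ) (K : Type) [Field K] [NumberField K], kolyvagin N W K)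
    (hMNU : MatarNekovar2019.thm07_padicValNat_card_sha_primary_add_le_of_globalDivisibility_of_irreducible) :
    (∀ (W : WeierstrassCurve ℚ) [W.IsElliptic] [W.IsGloballyMinimal] (N : ℕ) [NeZero N] (K : Type) [Field K] [NumberField K]
      (Dt : ModularParametrizationData W N) (H : HeegnerDatum N (NumberField.discr K)) (ι : K →+* ℂ) (P : (W.baseChange K).toAffine.Point),
      ClassO6 W 3 → W.HasSurjectiveModNGaloisRep 3 → W.analyticRank = 1 → W.conductorNorm ℤ = N → IsImaginaryQuadratic K →
      SatisfiesHeegnerHypothesis N K → (W.quadraticTwist (NumberField.discr K : ℚ)).entireLFunction 1 ≠ 0 →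
      WeierstrassCurve.Affine.Point.map ι.toRatAlgHom P = heegnerPointComplex Dt H → ¬ IsOfFinAddOrder P → Odd (NumberField.discr K) →
      Koly.Minf Dt H.β ι 3 ≤ ((padicValNat 3 W.tamagawaProduct + padicValNat 3 Dt.c.natAbs : ℕ) : ℕ∞)) ↔
    (∀ (W : WeierstrassCurve ℚ) [W.IsElliptic] [W.IsGloballyMinimal] (N : ℕ) [NeZero N] (K : Type) [Field K] [NumberField K]
      (Dt : ModularParametrizationData W N) (H : HeegnerDatum N (NumberField.discr K)) (ι : K →+* ℂ) (P : (W.baseChange K).toAffine.Point),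
      ClassO6 W 3 → W.HasSurjectiveModNGaloisRep 3 → W.analyticRank = 1 → W.conductorNorm ℤ = N → IsImaginaryQuadratic K →
      SatisfiesHeegnerHypothesis N K → (W.quadraticTwist (NumberField.discr K : ℚ)).entireLFunction 1 ≠ 0 →
      WeierstrassCurve.Affine.Point.map ι.toRatAlgHom P = heegnerPointComplex Dt H → ¬ IsOfFinAddOrder P → Odd (NumberField.discr K) →
      padicValNat 3 W.tamagawaProduct + padicValNat 3 Dt.c.natAbs < padicValNat 3 (AddSubgroup.zmultiples P).index →
      Koly.Minf Dt H.β ι 3 ≤ ((padicValNat 3 W.tamagawaProduct + padicValNat 3 Dt.c.natAbs : ℕ) : ℕ∞)) := by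
  refine ⟨fun h W _ _ N _ K _ _ Dt H ι P hO6 hsurj hr hN hK hHH hLt hP hnt hodd _ ↦
    h W N K Dt H ι P hO6 hsurj hr hN hK hHH hLt hP hnt hodd, fun h W _ _ N _ K _ _ Dt H ι P hO6 hsurj hr hN hK hHH hLt hP hnt hodd ↦ ?_⟩
  by_cases hx : padicValNat 3 W.tamagawaProduct + padicValNat 3 Dt.c.natAbs < padicValNat 3 (AddSubgroup.zmultiples P).index
  · exact h W N K Dt H ι P hO6 hsurj hr hN hK hHH hLt hP hnt hodd hx
  · exact minf_le_of_index_le_budget hKo hMNU W N K Dt H ι P hO6 hsurj hN hK hHH hP hnt hodd (not_lt.mp hx)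

/-! ### §2 What a counterexample to crux #2″ must be -/

/-- **The crux forbids global `3^{s}`-divisibility to depth `ord₃∏c_ℓ + v₃(c) + 1` at any datum.** GIVEN print {PUB, W, Matar–Nekovář
upper} and `E_𝟙^V`: at every datum of the stub's binders it is NOT the case that every derived Heegner point `P_n` (`n` a square-free
product of Kolyvagin primes of index `≥ s`, `n = 1` allowed; any Kolyvagin–Heegner datum `d` of conductor `n` on `(Dt, H.β, ι)`) is
`3^{s}`-divisible in `E(K[n])` for every `s ≤ ord₃∏c_ℓ + v₃(c) + 1` — for that would be `M_∞ ≥ budget + 1`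
(`Koly.globalDivisibility_iff_le_minf`, definitions only) against p635290 §2 (`M_∞ ≤ budget`). CONDITIONAL; nothing asserted about any
curve. [cite: McCallumLMS1991, §5 (p. 303) definitions of ord_p(P_n), M_r; Cor. 5.6 (p. 310)] [cite: MatarNekovar2019, Thm. 0.7 (p. 456)] -/
theorem not_globalDivisibility_of_valueAtOneV (hF : PublishedInputsWildThree) (hW : WildSplitPrintedInputsAtThree)
    (hMNU : MatarNekovar2019.thm07_padicValNat_card_sha_primary_add_le_of_globalDivisibility_of_irreducible)
    (hE1V : WildSplitEisensteinValueAtOneV)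
    (W : WeierstrassCurve ℚ) [W.IsElliptic] [W.IsGloballyMinimal] (N : ℕ) [NeZero N]
    (K : Type) [Field K] [NumberField K]
    (Dt : ModularParametrizationData W N) (H : HeegnerDatum N (NumberField.discr K)) (ι : K →+* ℂ)
    (P : (W.baseChange K).toAffine.Point)
    (hO6 : Additive.ClassO6 W 3) (hsurj : W.HasSurjectiveModNGaloisRep 3) (hr : W.analyticRank = 1) (hN : W.conductorNorm ℤ = N)
    (hK : IsImaginaryQuadratic K) (hHH : SatisfiesHeegnerHypothesis N K)
    (hLt : (W.quadraticTwist (NumberField.discr K : ℚ)).entireLFunction 1 ≠ 0)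
    (hP : WeierstrassCurve.Affine.Point.map ι.toRatAlgHom P = heegnerPointComplex Dt H)
    (hnt : ¬ IsOfFinAddOrder P) (hodd : Odd (NumberField.discr K)) :
    ¬ ∀ (s : ℕ), s ≤ padicValNat 3 W.tamagawaProduct + padicValNat 3 Dt.c.natAbs + 1 →
      ∀ (n : ℕ) (d : KolyvaginHeegnerData Dt H.β ι n), Squarefree n →
        (∀ ℓ ∈ n.primeFactors, Zhang2014.IsKolyvaginPrime N W K 3 ℓ ∧ s ≤ Zhang2014.kolyvaginIndex W 3 ℓ) → Koly.PDiv d 3 s := by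
  intro hglob
  have hle := WildSplitEisensteinValueAtOneVMinfCurrency.minfLeFH_of_valueAtOneV hF hW hMNU hE1V W N K Dt H ι P hO6 hsurj hr hN hK
    hHH hLt hP hnt hodd
  have hge := (Koly.globalDivisibility_iff_le_minf Dt H.β ι 3 _).mp hglob
  have := hge.trans hle
  exact absurd (ENat.coe_le_coe.mp this) (by omega)

/-- **THE SHAPE OF A REFUTATION of crux #2″** (modulo print {PUB, W, Matar–Nekovář upper}): exhibit ONE datum of the registered stub's
binders — `W` on `ClassO6 W 3` with `ρ̄₃` onto and `r_an = 1`, `N_E = N`, `K` imaginary quadratic Heegner for `N` with `L(E^(d_K),1) ≠ 0`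
and `d_K` odd, `(Dt, H, ι)`, `P ↦ heegnerPointComplex Dt H` of infinite order — at which EVERY derived Heegner point of the frame
`(Dt, H.β, ι)` is `3^{s}`-divisible to depth `ord₃∏c_ℓ(E) + v₃(c(Dt)) + 1`; then `¬ WildSplitEisensteinValueAtOneV`. (Such a datum has
index excess automatically: `n = 1` gives `3^{budget+1} ∣ y_K` in `E(K[1])`.) This is what the route's cheapest falsifier must produce;
the positive mirror (ONE certificate per index-excess datum proves `I_FH` there) is p621234 / p623400. CONDITIONAL on the three print
packages; NO datum is exhibited here and `E_𝟙^V` is NOT claimed false. [cite: McCallumLMS1991, §5 (p. 303) and Cor. 5.6 (p. 310)]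
[cite: MatarNekovar2019, Thm. 0.7 (p. 456)] [cite: JetchevLauterStein2009, Prop. 4.1–4.2 (arXiv:0707.0032)] -/
theorem valueAtOneV_false_of_globalDivisibility_datum (hF : PublishedInputsWildThree) (hW : WildSplitPrintedInputsAtThree)
    (hMNU : MatarNekovar2019.thm07_padicValNat_card_sha_primary_add_le_of_globalDivisibility_of_irreducible)
    (hex : ∃ (W : WeierstrassCurve ℚ) (_ : W.IsElliptic) (_ : W.IsGloballyMinimal) (N : ℕ) (_ : NeZero N)
      (K : Type) (_ : Field K) (_ : NumberField K) (Dt : ModularParametrizationData W N)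
      (H : HeegnerDatum N (NumberField.discr K)) (ι : K →+* ℂ) (P : (W.baseChange K).toAffine.Point),
      ClassO6 W 3 ∧ W.HasSurjectiveModNGaloisRep 3 ∧ W.analyticRank = 1 ∧ W.conductorNorm ℤ = N ∧
      IsImaginaryQuadratic K ∧ SatisfiesHeegnerHypothesis N K ∧
      (W.quadraticTwist (NumberField.discr K : ℚ)).entireLFunction 1 ≠ 0 ∧
      WeierstrassCurve.Affine.Point.map ι.toRatAlgHom P = heegnerPointComplex Dt H ∧ ¬ IsOfFinAddOrder P ∧
      Odd (NumberField.discr K) ∧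
      ∀ (s : ℕ), s ≤ padicValNat 3 W.tamagawaProduct + padicValNat 3 Dt.c.natAbs + 1 →
        ∀ (n : ℕ) (d : KolyvaginHeegnerData Dt H.β ι n), Squarefree n →
          (∀ ℓ ∈ n.primeFactors, Zhang2014.IsKolyvaginPrime N W K 3 ℓ ∧ s ≤ Zhang2014.kolyvaginIndex W 3 ℓ) → Koly.PDiv d 3 s) :
    ¬ WildSplitEisensteinValueAtOneV := by
  rintro hE1V
  obtain ⟨W, _, _, N, _, K, _, _, Dt, H, ι, P, hO6, hsurj, hr, hN, hK, hHH, hLt, hP, hnt, hodd, hglob⟩ := hex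
  exact not_globalDivisibility_of_valueAtOneV hF hW hMNU hE1V W N K Dt H ι P hO6 hsurj hr hN hK hHH hLt hP hnt hodd hglob

/-! ### §3 Crux #2″ as a ∀¬(global divisibility) statement -/

/-- **Modulo print {PUB, W, Matar–Nekovář 2019 Thm. 0.7 both readings}: `E_𝟙^V` ⟺ «at NO datum of the stub's binders are the derived
Heegner points globally `3^{s}`-divisible to depth `ord₃∏c_ℓ + v₃(c) + 1`»** — p635290 §2 read through
`Koly.globalDivisibility_iff_le_minf` (`¬ (budget + 1 ≤ M_∞) ⟺ M_∞ ≤ budget` in `ℕ∞`). The right side is what the instrument row decides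
pair by pair. An equivalence between OPEN statements; nothing asserted about any curve; closes nothing.
[cite: McCallumLMS1991, §5 (p. 303) and Cor. 5.6 (p. 310)] [cite: MatarNekovar2019, Thm. 0.7 (p. 456) and §0.11 (p. 457)] -/
theorem valueAtOneV_iff_forall_not_globalDivisibility (hF : PublishedInputsWildThree) (hW : WildSplitPrintedInputsAtThree)
    (hMNL : MatarNekovar2019.thm07_pow_dvd_card_sha_primary_of_certificate_of_irreducible)
    (hMNU : MatarNekovar2019.thm07_padicValNat_card_sha_primary_add_le_of_globalDivisibility_of_irreducible) :
    WildSplitEisensteinValueAtOneV ↔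
    ∀ (W : WeierstrassCurve ℚ) [W.IsElliptic] [W.IsGloballyMinimal] (N : ℕ) [NeZero N] (K : Type) [Field K] [NumberField K]
      (Dt : ModularParametrizationData W N) (H : HeegnerDatum N (NumberField.discr K)) (ι : K →+* ℂ) (P : (W.baseChange K).toAffine.Point),
      ClassO6 W 3 → W.HasSurjectiveModNGaloisRep 3 → W.analyticRank = 1 → W.conductorNorm ℤ = N → IsImaginaryQuadratic K →
      SatisfiesHeegnerHypothesis N K → (W.quadraticTwist (NumberField.discr K : ℚ)).entireLFunction 1 ≠ 0 →
      WeierstrassCurve.Affine.Point.map ι.toRatAlgHom P = heegnerPointComplex Dt H → ¬ IsOfFinAddOrder P → Odd (NumberField.discr K) →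
      ¬ ∀ (s : ℕ), s ≤ padicValNat 3 W.tamagawaProduct + padicValNat 3 Dt.c.natAbs + 1 →
        ∀ (n : ℕ) (d : KolyvaginHeegnerData Dt H.β ι n), Squarefree n →
          (∀ ℓ ∈ n.primeFactors, Zhang2014.IsKolyvaginPrime N W K 3 ℓ ∧ s ≤ Zhang2014.kolyvaginIndex W 3 ℓ) → Koly.PDiv d 3 s := by
  rw [WildSplitEisensteinValueAtOneVMinfCurrency.valueAtOneV_iff_minfLeFH hF hW hMNL hMNU]
  refine forall_congr' fun W ↦ forall_congr' fun _ ↦ forall_congr' fun _ ↦ forall_congr' fun N ↦ forall_congr' fun _ ↦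
    forall_congr' fun K ↦ forall_congr' fun _ ↦ forall_congr' fun _ ↦ forall_congr' fun Dt ↦ forall_congr' fun H ↦
    forall_congr' fun ι ↦ forall_congr' fun P ↦ forall_congr' fun _ ↦ forall_congr' fun _ ↦ forall_congr' fun _ ↦
    forall_congr' fun _ ↦ forall_congr' fun _ ↦ forall_congr' fun _ ↦ forall_congr' fun _ ↦ forall_congr' fun _ ↦
    forall_congr' fun _ ↦ forall_congr' fun _ ↦ ?_
  constructor
  · intro hle hglob
    have hge := (Koly.globalDivisibility_iff_le_minf Dt H.β ι 3 _).mp hglob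
    exact absurd (ENat.coe_le_coe.mp (hge.trans hle)) (by omega)
  · intro h
    by_contra hlt
    refine h ((Koly.globalDivisibility_iff_le_minf Dt H.β ι 3 _).mpr ?_)
    rw [Nat.cast_succ]
    exact Order.add_one_le_of_lt (not_le.mp hlt)

/-! ### §4 The route's two research cruxes as ONE refined-Kolyvagin statement -/

/-- **J‴ ⟺ «`ord₃∏c_ℓ + v₃(c) ≤ M_∞` on every cut multi-carrier frame»** — DEFINITIONS ONLY (no print): the Kolyvagin column's crux
`WildSigmaDivisibilityAtThreeMultiCarrier` (item 25898) is, binder for binder, its tail read through `Koly.globalDivisibility_iff_le_minf`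
(tk5j's `…Negative.le_minf_of_wildSigmaDivisibilityAtThreeMultiCarrier` is ⟹; ⟸ is the same bridge read backwards). An `Iff` between an
OPEN statement and its rephrasing; nothing asserted about any curve. [cite: McCallumLMS1991, §5 (p. 303) definitions of ord_p(P_n), M_r; Cor. 5.6 (p. 310)] -/
theorem sigmaMultiCarrier_iff_le_minf :
    WildSigmaDivisibilityAtThreeMultiCarrier ↔
    ∀ (W : WeierstrassCurve ℚ) [W.IsElliptic] [W.IsGloballyMinimal] (N : ℕ) [NeZero N] (K : Type) [Field K] [NumberField K]
      (Dt : ModularParametrizationData W N) (H : HeegnerDatum N (NumberField.discr K)) (ι : K →+* ℂ) (P : (W.baseChange K).toAffine.Point),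
      ClassO6 W 3 → W.HasSurjectiveModNGaloisRep 3 → W.analyticRank = 1 → W.conductorNorm ℤ = N → IsImaginaryQuadratic K →
      SatisfiesHeegnerHypothesis N K → (W.quadraticTwist (NumberField.discr K : ℚ)).entireLFunction 1 ≠ 0 →
      WeierstrassCurve.Affine.Point.map ι.toRatAlgHom P = heegnerPointComplex Dt H → ¬ IsOfFinAddOrder P → Odd (NumberField.discr K) →
      NumberField.discr K ≠ -3 →
      (∀ (q : ℕ) [Fact q.Prime], q ∣ N →
        padicValNat 3 ((W.baseChange ℚ_[q]).localTamagawaNumber ℤ_[q]) < padicValNat 3 W.tamagawaProduct + padicValNat 3 Dt.c.natAbs) →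
      ((padicValNat 3 W.tamagawaProduct + padicValNat 3 Dt.c.natAbs : ℕ) : ℕ∞) ≤ Koly.Minf Dt H.β ι 3 :=
  forall_congr' fun _ ↦ forall_congr' fun _ ↦ forall_congr' fun _ ↦ forall_congr' fun _ ↦ forall_congr' fun _ ↦
    forall_congr' fun _ ↦ forall_congr' fun _ ↦ forall_congr' fun _ ↦ forall_congr' fun Dt ↦ forall_congr' fun H ↦
    forall_congr' fun ι ↦ forall_congr' fun _ ↦ forall_congr' fun _ ↦ forall_congr' fun _ ↦ forall_congr' fun _ ↦
    forall_congr' fun _ ↦ forall_congr' fun _ ↦ forall_congr' fun _ ↦ forall_congr' fun _ ↦ forall_congr' fun _ ↦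
    forall_congr' fun _ ↦ forall_congr' fun _ ↦ forall_congr' fun _ ↦ forall_congr' fun _ ↦
    Koly.globalDivisibility_iff_le_minf Dt H.β ι 3 _

/-- **Modulo print {PUB, W, Matar–Nekovář 2019 Thm. 0.7 both readings}: `E_𝟙^V ∧ J‴` ⟺ «`M_∞ ≤ ord₃∏c_ℓ + v₃(c)` at every odd
Friedberg–Hoffstein datum of the cell ∧ `M_∞ ≥ ord₃∏c_ℓ + v₃(c)` at every cut multi-carrier one»** — route `SemiOrdinaryEisensteinDescent`'s
two OPEN research cruxes (#2″ E_𝟙^V 26610, #3‴ J‴ 25898; the third open item Z 20387 is the rank-0 wild leaf by name) are TOGETHER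
W. Zhang's refined Kolyvagin conjecture at the wild `3` in McCallum's currency with the Manin slack, split into its two inequalities
(p635290 §2 `valueAtOneV_iff_minfLeFH` ∧ `sigmaMultiCarrier_iff_le_minf`). An equivalence between OPEN statements; nothing asserted about
any curve; closes nothing; BSD₃ is proved for no curve. [cite: WZhang2014, Remark 18 and Thm. 10.2] [cite: Jetchev2008, Conj. 1.3]
[cite: MatarNekovar2019, Thm. 0.7 (p. 456) and §0.11 (p. 457)] [cite: McCallumLMS1991, §5 Cor. 5.6 (p. 310)] -/
theorem valueAtOneV_and_sigmaMultiCarrier_iff_refinedKolyvagin (hF : PublishedInputsWildThree) (hW : WildSplitPrintedInputsAtThree)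
    (hMNL : MatarNekovar2019.thm07_pow_dvd_card_sha_primary_of_certificate_of_irreducible)
    (hMNU : MatarNekovar2019.thm07_padicValNat_card_sha_primary_add_le_of_globalDivisibility_of_irreducible) :
    (WildSplitEisensteinValueAtOneV ∧ WildSigmaDivisibilityAtThreeMultiCarrier) ↔
    ((∀ (W : WeierstrassCurve ℚ) [W.IsElliptic] [W.IsGloballyMinimal] (N : ℕ) [NeZero N] (K : Type) [Field K] [NumberField K]
      (Dt : ModularParametrizationData W N) (H : HeegnerDatum N (NumberField.discr K)) (ι : K →+* ℂ) (P : (W.baseChange K).toAffine.Point),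
      ClassO6 W 3 → W.HasSurjectiveModNGaloisRep 3 → W.analyticRank = 1 → W.conductorNorm ℤ = N → IsImaginaryQuadratic K →
      SatisfiesHeegnerHypothesis N K → (W.quadraticTwist (NumberField.discr K : ℚ)).entireLFunction 1 ≠ 0 →
      WeierstrassCurve.Affine.Point.map ι.toRatAlgHom P = heegnerPointComplex Dt H → ¬ IsOfFinAddOrder P → Odd (NumberField.discr K) →
      Koly.Minf Dt H.β ι 3 ≤ ((padicValNat 3 W.tamagawaProduct + padicValNat 3 Dt.c.natAbs : ℕ) : ℕ∞)) ∧
    (∀ (W : WeierstrassCurve ℚ) [W.IsElliptic] [W.IsGloballyMinimal] (N : ℕ) [NeZero N] (K : Type) [Field K] [NumberField K]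
      (Dt : ModularParametrizationData W N) (H : HeegnerDatum N (NumberField.discr K)) (ι : K →+* ℂ) (P : (W.baseChange K).toAffine.Point),
      ClassO6 W 3 → W.HasSurjectiveModNGaloisRep 3 → W.analyticRank = 1 → W.conductorNorm ℤ = N → IsImaginaryQuadratic K →
      SatisfiesHeegnerHypothesis N K → (W.quadraticTwist (NumberField.discr K : ℚ)).entireLFunction 1 ≠ 0 →
      WeierstrassCurve.Affine.Point.map ι.toRatAlgHom P = heegnerPointComplex Dt H → ¬ IsOfFinAddOrder P → Odd (NumberField.discr K) →
      NumberField.discr K ≠ -3 →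
      (∀ (q : ℕ) [Fact q.Prime], q ∣ N →
        padicValNat 3 ((W.baseChange ℚ_[q]).localTamagawaNumber ℤ_[q]) < padicValNat 3 W.tamagawaProduct + padicValNat 3 Dt.c.natAbs) →
      ((padicValNat 3 W.tamagawaProduct + padicValNat 3 Dt.c.natAbs : ℕ) : ℕ∞) ≤ Koly.Minf Dt H.β ι 3)) :=
  and_congr (WildSplitEisensteinValueAtOneVMinfCurrency.valueAtOneV_iff_minfLeFH hF hW hMNL hMNU) sigmaMultiCarrier_iff_le_minf

end Summit.BirchSwinnertonDyer.BirchSwinnertonDyer.Theorems.WildSplitEisensteinValueAtOneVMinfShape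

end
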